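import Summits.Langlands.Langlands.Theorems.QuadraticWindowHostInducedRepInducedCharpoly
import Summits.Langlands.Langlands.Theses.QuadraticWindow
import Literature.NumberTheory.Automorphic.ReciprocityGLn
import Literature.NumberTheory.Automorphic.ReciprocityGLnDescentProofs
import Literature.NumberTheory.Automorphic.AshSmithTheoryHeckeProofs
import Literature.NumberTheory.GaloisRepresentations.HeckeCharacterGaloisAvatarProofs
import Literature.NumberTheory.GaloisRepresentations.FramedRepTwist
import Literature.NumberTheory.GaloisRepresentations.TwistedSumAssembly
import Summits.Langlands.Langlands.Theorems.IrreducibilityBySelfDualityIrreducibleGL3CMContinuousSemisimplification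
import Summits.Langlands.Langlands.Theorems.QuadraticWindowTwistUnpackagingAssembly
import HarnessLib

/-!
# The totally real stratum: induction of the twisted Galois representation of `π` —
stub `stub_totallyRealInduction` of line `one-transparent-pane`
(crux `Summit.Langlands.Langlands.Theses.QuadraticWindow.HostInducedRep`, item stmt-Langlands-10902)

Setting.  `F/F₀` a quadratic extension of number fields, `π` a cuspidal regular algebraic
automorphic representation of `GL_n(𝔸_F)`, `eψ : Γ_F → GL_1(ℂ)` a rank-one Artin representation,
`ℓ` a prime and `ι : ℚ̄_ℓ ≃+* ℂ`.

Statement (`stub_totallyRealInduction_cond`, the registered signature of `stub_totallyRealInduction`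
VERBATIM, conditional on the tree named fact lang.S27
`Literature.NumberTheory.Automorphic.exists_galoisRep_of_regularAlgebraic` = Harris–Lan–Taylor–Thorne
Thm. A + Varma).  If `F` is TOTALLY REAL there is a continuous semisimple
`R : Γ_{F₀} → GL_{2n}(ℚ̄_ℓ)` which, at every finite place `v ∤ ℓ` of `F₀` above which `F/F₀`, `π` and
`eψ` are unramified (Satake parameters `α_w`, Frobenius values `c_w` of `eψ`), is unramified with
Frobenius characteristic polynomial the host polynomial
`∏_{w ∣ v} P_w(X^{f(w∣v)})`, `P_w = arithFrobPolyOfSatake ι q_w n (α_w · c_w)`.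

Proof (`R = Ind_{Γ_F}^{Γ_{F₀}}(ρ_π ⊗ ẽψ)`, = `Cruxes/HostInducedRep/Disproof.lean` §9
`hostConclusion_of_reciprocity_of_induction` with both inputs supplied):
1. `ρ := r_{ℓ,ι}(π)` (lang.S27, hypothesis `hS27`): unramified with polynomial
   `arithFrobPolyOfSatake ι q_w n α` at every `w ∤ ℓ` with Satake parameter `α`.
2. `exists_twist_package`: `ρ' := ρ ⊗ ẽψ`, `ẽψ = σ ↦ ι⁻¹(eψ(σ))⁻¹` the `ℓ`-adic avatar
   (`FramedArtinRep.lAdicAvatar`, `FramedRep.twist`); at a good `w` the roots are multiplied by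
   `ι⁻¹(c_w⁻¹)`, which turns `arithFrobPolyOfSatake ι q_w n α` into `arithFrobPolyOfSatake ι q_w n (α·c_w)`.
3. `exists_semisimple_induce_package` (FACT-FREE, every rank, every finite Galois `F/F₀`): the
   continuous semisimplification of `Ind ρ'` is unramified with polynomial `∏_{w∣v} P_w(X^{f(w∣v)})`
   at every `v` with `e(w∣v) = 1` above which `ρ'` is unramified with polynomials `P_w`
   (`FramedGaloisRep.induce`, `isUnramifiedAt_induce`, `inertia_le_range_absGaloisRestrict`,
   `exists_charpoly_induce_eq_prod_expand` of the companion helper, continuous semisimplification).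
   By-product: `hasQuadraticInduction` — `HasQuadraticInduction F₀ F ℓ n` of `Disproof.lean` §9 in
   every rank `n` (its rank-one case is `Disproof.lean` §11).
4. `[F : F₀] = 2` is Galois; `ℓ ∉ w` for `w ∣ v` because `ℓ ∉ v`.

LOG (worker, 2026-08-16).
* PROVED: `stub_totallyRealInduction_cond (hS27 : exists_galoisRep_of_regularAlgebraic) :
  <registered signature verbatim>`; hypothesis = the EXISTING Literature named fact lang.S27
  (`Literature/NumberTheory/Automorphic/ReciprocityGLn.lean`), nothing else; fact-free by-products
  `exists_semisimple_induce_package`, `hasQuadraticInduction`, `exists_twist_package`.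
* Helpers (land first, in this order): `QuadraticWindowHostInducedRepInducedCharpolyBlocks.lean`
  (`work/stubs/InducedCharpolyBlocks.lean`), `QuadraticWindowHostInducedRepInducedCharpoly.lean`
  (`work/stubs/InducedCharpoly.lean`); this file imports the second.
* `lean check`: helper 1 standalone rc 0 / 0 warnings; the exact concatenation of the three files
  (`work/stubs/scratch_tri/Concat3.lean`; helpers 2 and this file import not-yet-landed modules, so
  they cannot be checked standalone before the helpers land) rc 0, errors [], warnings [], sorries 0;
  axioms of `stub_totallyRealInduction_cond`, `hasQuadraticInduction`, `charpoly_comp_indMatrix_eq_prod`: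
  {propext, Classical.choice, Quot.sound}; `work/stubs/scratch_tri/SigProbe.lean` (rc 0) checks
  `example (hS27) : <registered signature, in the skeleton's namespace/opens> := …_cond hS27`.

References: M. Harris, K.-W. Lan, R. Taylor, J. Thorne, Res. Math. Sci. 3 (2016), Thm. A
[HarrisLanTaylorThorneRMS2016]; J.-P. Serre, *Abelian ℓ-adic representations* (1968), Ch. I §2,
Ch. III §2.3 [SerreAbelianLadic1968]; J.-P. Serre, *Linear representations of finite groups* (1977),
§3.3, §7.3 [SerreLinearRepresentations1977].
-/

set_option linter.dupNamespace false -- project-wide option (lakefile weak.linter.dupNamespace); `Summit.Langlands.Langlands` is the mandated namespace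

noncomputable section

open Polynomial
open scoped NumberField
open IsDedekindDomain Field NumberField
open Literature.NumberTheory.GaloisRepresentations Literature.NumberTheory.Automorphic

namespace Summit.Langlands.Langlands.Theorems.HostInducedRep.OneTransparentPane

/-! ### Induction of Frobenius packages, the twist by the avatar of `eψ`, and the stub -/

section Stub

open scoped NumberField
open IsDedekindDomain Field NumberField
open Literature.NumberTheory.GaloisRepresentations Literature.NumberTheory.Automorphic
open Summit.Langlands.Langlands.Theorems.TwistUnpackaging.KummerChebotarev
  (eq_of_monic_of_roots_eq monic_arithFrobPolyOfSatake)

variable {F₀ F : Type} [Field F₀] [NumberField F₀] [Field F] [NumberField F] [Algebra F₀ F]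

/-- **Induction of Frobenius packages along a finite Galois extension, in every rank (fact-free).**
Let `F/F₀` be a finite Galois extension of number fields of degree `d`, `ℓ` a prime and
`ρ : Γ_F → GL_m(ℚ̄_ℓ)` continuous.  Then there is a continuous SEMISIMPLE `R : Γ_{F₀} → GL_{d m}(ℚ̄_ℓ)`
(a continuous semisimplification of `Ind_{Γ_F}^{Γ_{F₀}} ρ`) such that, at every finite place `v` of
`F₀` all of whose places `w ∣ v` in `F` satisfy `e(w|v) = 1`, `ρ` unramified at `w` with Frobenius
characteristic polynomial `P_w`, the representation `R` is unramified with Frobenius characteristic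
polynomial `∏_{w ∣ v} P_w(X^{f(w|v)})`.
Proof: `FramedGaloisRep.induce`; `inertia_le_range_absGaloisRestrict` (+
`ramificationIdxIn_eq_one_of_isUnramifiedIn`) turns `e(w|v) = 1` into `I_𝔓 ≤ res(Γ_F)`;
`FramedGaloisRep.isUnramifiedAt_induce`; the induced Frobenius polynomial is
`exists_charpoly_induce_eq_prod_expand`; `IrreducibleGL3CM.stub_continuousSemisimplification` keeps
characteristic polynomials and kernel.  (Rank one, `d = 2`: `Disproof.lean` §11.)
Ref: Serre, *Linear representations of finite groups*, §3.3, §7.3; Neukirch, *Algebraic Number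
Theory*, VII §10 (10.4). [folklore] -/
theorem exists_semisimple_induce_package [IsGalois F₀ F] {d : ℕ} (hd : Module.finrank F₀ F = d)
    {ℓ : ℕ} [Fact ℓ.Prime] {m : ℕ} (ρ : FramedGaloisRep F (PadicAlgCl ℓ) m) :
    ∃ R : FramedGaloisRep F₀ (PadicAlgCl ℓ) (d * m), R.toGaloisRep.IsSemisimple ∧
      ∀ (v : HeightOneSpectrum (𝓞 F₀)) (P : HeightOneSpectrum (𝓞 F) → (PadicAlgCl ℓ)[X]),
        (∀ w : HeightOneSpectrum (𝓞 F), w.under (𝓞 F₀) = v →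
          w.asIdeal.ramificationIdx (𝓞 F₀) = 1 ∧ ρ.IsUnramifiedAt w ∧ ρ.HasFrobCharpolyAt w (P w)) →
        R.IsUnramifiedAt v ∧ R.HasFrobCharpolyAt v
          (∏ᶠ w ∈ {w : HeightOneSpectrum (𝓞 F) | w.under (𝓞 F₀) = v},
            expand (PadicAlgCl ℓ) (w.asIdeal.inertiaDeg (𝓞 F₀)) (P w)) := by
  classical
  -- the induced representation and its continuous semisimplification
  obtain ⟨R, hRss, hRchar, hRone⟩ :=
    Summit.Langlands.Langlands.Theorems.IrreducibleGL3CM.stub_continuousSemisimplification F₀ ℓ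
      (d * m) (FramedGaloisRep.induce F₀ hd ρ)
  refine ⟨R, hRss, fun v P hfib ↦ ?_⟩
  -- the arithmetic guard makes `v` unramified in `F`, so inertia above `v` lies in `res(Γ_F)`
  have hunrIn : Algebra.IsUnramifiedIn (𝓞 F) v.asIdeal := by
    rw [Algebra.isUnramifiedIn_iff_forall_ramificationIdx_eq_one]
    intro 𝔓 _ h𝔓
    have hne : 𝔓 ≠ ⊥ := Ideal.ne_bot_of_liesOver_of_ne_bot v.ne_bot 𝔓
    exact (hfib ⟨𝔓, inferInstance, hne⟩ (HeightOneSpectrum.ext h𝔓.over.symm)).1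
  have he : v.asIdeal.ramificationIdxIn (𝓞 F) = 1 :=
    ramificationIdxIn_eq_one_of_isUnramifiedIn hunrIn
  have hIn : ∀ 𝔓 ∈ v.primesAbove,
      𝔓.inertia (absoluteGaloisGroup F₀) ≤ (absGaloisRestrict F₀ F).range :=
    fun 𝔓 h𝔓 ↦ inertia_le_range_absGaloisRestrict F₀ F he h𝔓
  -- `Ind ρ` is unramified at `v`, hence so is its semisimplification
  have hIunr : (FramedGaloisRep.induce F₀ hd ρ).IsUnramifiedAt v :=
    FramedGaloisRep.isUnramifiedAt_induce F₀ hd ρ hIn fun w hw ↦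
      (hfib w (HeightOneSpectrum.ext (by rw [HeightOneSpectrum.under_asIdeal]; exact hw))).2.1
  refine ⟨fun 𝔓 h𝔓 σ hσ ↦ hRone σ (hIunr 𝔓 h𝔓 σ hσ), fun 𝔓 h𝔓 σ hσ ↦ ?_⟩
  -- the fibre of `v` is finite (adapted from Cruxes/HostInducedRep/Disproof.lean §3 `finite_fibre`)
  have hfin : {w : HeightOneSpectrum (𝓞 F) | w.under (𝓞 F₀) = v}.Finite := by
    refine ((IsDedekindDomain.primesOver_finite v.asIdeal (𝓞 F)).preimage
      (f := fun w : HeightOneSpectrum (𝓞 F) ↦ w.asIdeal)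
      (fun w _ w' _ h ↦ HeightOneSpectrum.ext h)).subset fun w hw ↦ ?_
    refine ⟨w.isPrime, ⟨?_⟩⟩
    rw [Set.mem_setOf_eq] at hw
    rw [← hw, HeightOneSpectrum.under_asIdeal]
  haveI : Fintype {w : HeightOneSpectrum (𝓞 F) // w.under (𝓞 F₀) = v} := hfin.fintype
  -- Frobenius polynomial of `Ind ρ` at `σ`: `∏_{w ∣ v} charpoly(ρ(s_w))(X^{f(w∣v)})`
  obtain ⟨𝔔, s, hs, hchar⟩ :=
    exists_charpoly_induce_eq_prod_expand (K := F₀) hd ρ h𝔓 (hIn 𝔓 h𝔓) hσ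
  rw [hRchar σ, hchar]
  have hfac : ∀ w : {w : HeightOneSpectrum (𝓞 F) // w.under (𝓞 F₀) = v},
      expand (PadicAlgCl ℓ) (w.1.asIdeal.inertiaDeg (𝓞 F₀)) (FramedRep.charpoly ρ (s w)) =
        expand (PadicAlgCl ℓ) (w.1.asIdeal.inertiaDeg (𝓞 F₀)) (P w.1) := fun w ↦ by
    rw [(hfib w.1 w.2).2.2 (𝔔 w) (hs w).1 (s w) (hs w).2]
  -- `∏ w : {w // w ∣ v}` versus the crux's `∏ᶠ w ∈ {w | w ∣ v}` (adapted from Disproof.lean §11)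
  rw [Fintype.prod_congr _ _ hfac, finprod_mem_eq_finite_toFinset_prod _ hfin]
  exact (Finset.prod_subtype (p := fun w : HeightOneSpectrum (𝓞 F) ↦ w.under (𝓞 F₀) = v)
    hfin.toFinset (fun x ↦ by exact hfin.mem_toFinset)
    fun w ↦ expand (PadicAlgCl ℓ) (w.asIdeal.inertiaDeg (𝓞 F₀)) (P w)).symm

/-- **`HasQuadraticInduction F₀ F ℓ n` holds in every rank** (the Galois half of the crux, in the
sense of `Cruxes/HostInducedRep/Disproof.lean` §9, whose `def HasQuadraticInduction` is restated
here verbatim as the type): for `[F : F₀] = 2` and every semisimple `ρ : Γ_F → GL_n(ℚ̄_ℓ)` there is a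
semisimple `R : Γ_{F₀} → GL_{2n}(ℚ̄_ℓ)` which, at every place `v` of `F₀` unramified in `F` above
which `ρ` is unramified with Frobenius polynomials `P_w`, is unramified with Frobenius polynomial
`∏_{w ∣ v} P_w(X^{f(w∣v)})`.  (A quadratic extension is Galois, Mathlib
`Algebra.IsQuadraticExtension`; then `exists_semisimple_induce_package`.)
Ref: Serre, *Linear representations of finite groups*, §3.3, §7.3. [folklore] -/
theorem hasQuadraticInduction (F₀ F : Type) [Field F₀] [NumberField F₀] [Field F] [NumberField F]
    [Algebra F₀ F] (ℓ : ℕ) [Fact ℓ.Prime] (n : ℕ) (hdeg : Module.finrank F₀ F = 2) :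
    ∀ ρ : FramedGaloisRep F (PadicAlgCl ℓ) n, ρ.toGaloisRep.IsSemisimple →
      ∃ R : FramedGaloisRep F₀ (PadicAlgCl ℓ) (2 * n), R.toGaloisRep.IsSemisimple ∧
        ∀ (v : HeightOneSpectrum (𝓞 F₀)) (P : HeightOneSpectrum (𝓞 F) → (PadicAlgCl ℓ)[X]),
          (∀ w : HeightOneSpectrum (𝓞 F), w.under (𝓞 F₀) = v →
            w.asIdeal.ramificationIdx (𝓞 F₀) = 1 ∧ ρ.IsUnramifiedAt w ∧ ρ.HasFrobCharpolyAt w (P w)) →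
          R.IsUnramifiedAt v ∧ R.HasFrobCharpolyAt v
            (∏ᶠ w ∈ {w : HeightOneSpectrum (𝓞 F) | w.under (𝓞 F₀) = v},
              expand (PadicAlgCl ℓ) (w.asIdeal.inertiaDeg (𝓞 F₀)) (P w)) := by
  intro ρ _
  haveI : Algebra.IsQuadraticExtension F₀ F := ⟨hdeg⟩  -- hence `IsGalois F₀ F` (Mathlib)
  exact exists_semisimple_induce_package hdeg ρ

/-- **Twisting a Frobenius package by the `ℓ`-adic avatar of a rank-one Artin representation.**
If `ρ : Γ_F → GL_n(ℚ̄_ℓ)` is unramified with Frobenius polynomial `arithFrobPolyOfSatake ι q_w n α`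
at every `w ∤ ℓ` where `π` has Satake parameter `α`, then `ρ' := ρ ⊗ ẽψ` with
`ẽψ = det ∘ (eψ.lAdicAvatar ι) : σ ↦ ι⁻¹(eψ(σ))⁻¹` is unramified with Frobenius polynomial
`arithFrobPolyOfSatake ι q_w n (α · c)` at every such `w` where moreover `eψ` is unramified with
Frobenius value `c`: the roots `ι⁻¹(((√q_w)^{n-1} a c)⁻¹) = ι⁻¹(c⁻¹) · ι⁻¹(((√q_w)^{n-1} a)⁻¹)` are
`ẽψ(Frob_w)` times the roots of the untwisted polynomial (`TwistedSum.roots_charpoly_smul`,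
`hasFrobCharpolyAt_lAdicAvatar`); rank one: `Disproof.lean` §12.
Ref: Serre, *Abelian ℓ-adic representations* (1968), Ch. III §2.3. [folklore] -/
theorem exists_twist_package {ℓ : ℕ} [Fact ℓ.Prime] {n : ℕ} (ι : PadicAlgCl ℓ ≃+* ℂ)
    {hcpt : isCompact_glFiniteIntegralLevel n F} (π : CuspidalAutomorphicRepData n F hcpt)
    (eψ : FramedGaloisRep F ℂ 1) (ρ : FramedGaloisRep F (PadicAlgCl ℓ) n)
    (hρ : ∀ (w : HeightOneSpectrum (𝓞 F)) (α : Multiset ℂ), π.1.HasSatakeParamAt w α →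
      ((ℓ : ℕ) : 𝓞 F) ∉ w.asIdeal →
        ρ.IsUnramifiedAt w ∧ ρ.HasFrobCharpolyAt w (arithFrobPolyOfSatake ι w.residueCard n α)) :
    ∃ ρ' : FramedGaloisRep F (PadicAlgCl ℓ) n,
      ∀ (w : HeightOneSpectrum (𝓞 F)) (α : Multiset ℂ) (c : ℂ), ((ℓ : ℕ) : 𝓞 F) ∉ w.asIdeal →
        π.1.HasSatakeParamAt w α → eψ.IsUnramifiedAt w → eψ.HasFrobCharpolyAt w (X - C c) →
        ρ'.IsUnramifiedAt w ∧
          ρ'.HasFrobCharpolyAt w (arithFrobPolyOfSatake ι w.residueCard n (α.map (fun a ↦ a * c))) := by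
  refine ⟨ρ.twist (FramedRep.det (FramedArtinRep.lAdicAvatar eψ ι)), fun w α c hℓ hα hψu hψc ↦ ?_⟩
  obtain ⟨hρu, hρc⟩ := hρ w α hα hℓ
  have hAu : (FramedArtinRep.lAdicAvatar eψ ι).IsUnramifiedAt w :=
    (FramedArtinRep.isUnramifiedAt_lAdicAvatar_iff eψ ι w).mpr hψu
  have hAc := FramedArtinRep.hasFrobCharpolyAt_lAdicAvatar eψ ι hψc
  refine ⟨fun 𝔓 h𝔓 τ hτ ↦ ?_, fun 𝔓 h𝔓 σ hσ ↦ ?_⟩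
  · -- unramified: both factors die on inertia
    have h1 : ρ τ = 1 := hρu 𝔓 h𝔓 τ hτ
    have h2 : FramedArtinRep.lAdicAvatar eψ ι τ = 1 := hAu 𝔓 h𝔓 τ hτ
    have h3 : FramedRep.det (FramedArtinRep.lAdicAvatar eψ ι) τ = 1 := by
      rw [FramedRep.det_apply, h2, map_one]
    rw [FramedRep.twist_apply_of_eq_one _ _ h3, h1]
  · -- Frobenius: the roots are scaled by `ι⁻¹(c⁻¹)`
    have hρσ : FramedRep.charpoly ρ σ = arithFrobPolyOfSatake ι w.residueCard n α := hρc 𝔓 h𝔓 σ hσ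
    have hAσ := (FramedGaloisRep.hasFrobCharpolyAt_iff_of_rank_one _ w _).mp hAc 𝔓 h𝔓 σ hσ
    have hdet : ((FramedRep.det (FramedArtinRep.lAdicAvatar eψ ι) σ : (PadicAlgCl ℓ)ˣ) :
        PadicAlgCl ℓ) = ι.symm c⁻¹ := by
      rw [FramedRep.det_apply, Matrix.GeneralLinearGroup.val_det_apply, Matrix.det_fin_one, hAσ]
    have hk0 : ι.symm c⁻¹ ≠ 0 := by
      rw [← hdet]
      exact Units.ne_zero _
    unfold FramedRep.charpoly at hρσ ⊢
    rw [FramedRep.coe_twist_apply, hdet]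
    refine eq_of_monic_of_roots_eq (Matrix.charpoly_monic _) (monic_arithFrobPolyOfSatake ι _ n _) ?_
    rw [TwistedSum.roots_charpoly_smul _ hk0, hρσ, roots_arithFrobPolyOfSatake,
      roots_arithFrobPolyOfSatake, Multiset.map_map, Multiset.map_map]
    refine Multiset.map_congr rfl fun a _ ↦ ?_
    simp only [Function.comp_apply, ← map_mul]
    congr 1
    rw [mul_comm, ← mul_inv, mul_assoc]

/-- **Stub 7 (`stub_totallyRealInduction`) of line `one-transparent-pane`, registered signature
VERBATIM, conditional on lang.S27** (`hS27`, the tree named fact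
`Literature.NumberTheory.Automorphic.exists_galoisRep_of_regularAlgebraic`: Harris–Lan–Taylor–Thorne
Thm. A + Varma, Galois representations for regular algebraic cuspidal `π` over a totally real or CM
field, unramified with `arithFrobPolyOfSatake ι q_w n α` at every unramified `w ∤ ℓ`).  For `F`
TOTALLY REAL, quadratic over `F₀`, every cuspidal regular algebraic `π` on `GL_n(𝔸_F)` and every
rank-one Artin representation `eψ` of `Γ_F`: there is a continuous semisimple
`R : Γ_{F₀} → GL_{2n}(ℚ̄_ℓ)`, unramified with the host polynomial `∏_{w∣v} P_w(X^{f(w∣v)})`,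
`P_w = arithFrobPolyOfSatake ι q_w n (α_w · c_w)`, at every `v ∤ ℓ` above which `F/F₀`, `π` and `eψ`
are unramified (`α_w` the Satake parameter, `c_w` the Frobenius value of `eψ`).
Proof (= `Disproof.lean` §9 `hostConclusion_of_reciprocity_of_induction` with its two inputs
supplied): `ρ := r_{ℓ,ι}(π)` from `hS27` (`IsTotallyReal F`); `ρ' := ρ ⊗ ẽψ`
(`exists_twist_package`); `R :=` the semisimplified `Ind_{Γ_F}^{Γ_{F₀}} ρ'`
(`exists_semisimple_induce_package`, `[F : F₀] = 2` is Galois), fed on the fibre of a good `v` with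
`P_w` (`ℓ ∉ w` because `ℓ ∉ v = w ∩ 𝓞 F₀`).
[cite: HarrisLanTaylorThorneRMS2016, Thm. A] -/
theorem stub_totallyRealInduction_cond :
    exists_galoisRep_of_regularAlgebraic →
    ∀ (F₀ F : Type) [Field F₀] [NumberField F₀] [Field F] [NumberField F] [Algebra F₀ F]
      (n : ℕ) (hcpt : isCompact_glFiniteIntegralLevel n F) (π : CuspidalAutomorphicRepData n F hcpt)
      (ℓ : ℕ) [Fact ℓ.Prime] (ι : PadicAlgCl ℓ ≃+* ℂ) (eψ : FramedGaloisRep F ℂ 1),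
      NumberField.IsTotallyReal F → Module.finrank F₀ F = 2 → π.1.IsRegularAlgebraic →
    ∃ R : FramedGaloisRep F₀ (PadicAlgCl ℓ) (2 * n), R.toGaloisRep.IsSemisimple ∧
      ∀ (v : HeightOneSpectrum (𝓞 F₀)) (α : HeightOneSpectrum (𝓞 F) → Multiset ℂ)
          (c : HeightOneSpectrum (𝓞 F) → ℂ), ((ℓ : ℕ) : 𝓞 F₀) ∉ v.asIdeal →
        (∀ w : HeightOneSpectrum (𝓞 F), w.under (𝓞 F₀) = v → w.asIdeal.ramificationIdx (𝓞 F₀) = 1 ∧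
            π.1.HasSatakeParamAt w (α w) ∧ eψ.IsUnramifiedAt w ∧
            eψ.HasFrobCharpolyAt w (Polynomial.X - Polynomial.C (c w))) →
        R.IsUnramifiedAt v ∧ R.HasFrobCharpolyAt v
          (∏ᶠ w ∈ {w : HeightOneSpectrum (𝓞 F) | w.under (𝓞 F₀) = v},
              Polynomial.expand (PadicAlgCl ℓ) (w.asIdeal.inertiaDeg (𝓞 F₀))
                (arithFrobPolyOfSatake ι w.residueCard n ((α w).map (fun a ↦ a * c w)))) := by
  intro hS27 F₀ F _ _ _ _ _ n hcpt π ℓ _ ι eψ hF hdeg hreg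
  -- (i) the Galois representation of `π` (lang.S27), (ii) its twist by the avatar of `eψ`
  obtain ⟨ρ, -, hρ⟩ := hS27 hcpt (Or.inl hF) π hreg ℓ ι
  obtain ⟨ρ', hρ'⟩ := exists_twist_package ι π eψ ρ hρ
  -- (iii)+(iv) induce along the quadratic (hence Galois) `F/F₀` and semisimplify
  haveI : Algebra.IsQuadraticExtension F₀ F := ⟨hdeg⟩
  obtain ⟨R, hRss, hR⟩ := exists_semisimple_induce_package hdeg ρ'
  refine ⟨R, hRss, fun v α c hv hguard ↦
    hR v (fun w ↦ arithFrobPolyOfSatake ι w.residueCard n ((α w).map (fun a ↦ a * c w)))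
      fun w hw ↦ ?_⟩
  obtain ⟨he, hsat, hψu, hψc⟩ := hguard w hw
  refine ⟨he, hρ' w (α w) (c w) ?_ hsat hψu hψc⟩
  -- `ℓ ∉ w` because `ℓ ∉ v = w ∩ 𝓞 F₀`
  have hmem : ((ℓ : ℕ) : 𝓞 F) ∈ w.asIdeal ↔ ((ℓ : ℕ) : 𝓞 F₀) ∈ (w.under (𝓞 F₀)).asIdeal := by
    rw [HeightOneSpectrum.under_asIdeal, Ideal.under_def, Ideal.mem_comap, map_natCast]
  rw [hmem, hw]
  exact hv

end Stub

end Summit.Langlands.Langlands.Theorems.HostInducedRep.OneTransparentPane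

end
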